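import Summits.Schanuel.Schanuel.Theorems.DiophantineDichotomyKhovanskiiApproxTypeEvDefs
import Summits.Schanuel.Schanuel.Theorems.DiophantineDichotomyKhovanskiiApproxTypeLWLayerPrinted
import Literature.NumberTheory.Transcendental.LindemannWeierstrassMeasure

/-!
# Route `DiophantineDichotomy`, crux `KhovanskiiApproxTypeEv`, line `anchored-reduction`:
# stub `stub_evLW_two_of_ably` — the `n = 2` Lindemann–Weierstrass layer from Ably's theorem

Crux `Summit.Schanuel.Schanuel.Theses.DiophantineDichotomy.KhovanskiiApproxTypeEv`
(item stmt-Schanuel-14972), line `anchored-reduction` (skeleton of line lead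
`prover-line-stmt-Schanuel-14972-0`), registered stub `stub_evLW_two_of_ably` (`--supports`).

`EvLWTwo` (vocabulary module `Theorems/DiophantineDichotomyKhovanskiiApproxTypeEvDefs.lean`) is the
Lindemann–Weierstrass layer of the eventual crux at `n = 2`: every `s ∈ ℚ̄²` with `ℚ`-linearly
independent coordinates has eventual approximation type `a < 1`, i.e.
`∃ a b C, a < 1 ∧ ApproxTypeEvAt 2 s a b C`.  It is THEOREM-GRADE conditional on ONE named fact,
`Literature.NumberTheory.Transcendental.Ably1994_lindemannWeierstrass_measure` (Ably 1994, Acta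
Arith. 67, Théorème p. 30: `log|P(e^{y})| ≥ −c₂ Dᵐ (log H + exp(C Dᵐ log(D+1)))`), which stays a
HYPOTHESIS here (it is the neighbouring stub `stub_lwMeasure` of the skeleton, never asserted).

## Proof

The whole analytic content is LANDED in
`Theorems/DiophantineDichotomyKhovanskiiApproxTypeLWLayerPrinted.lean` (p95225, namespace
`…KhovanskiiApproxType.HeightWindowCompactness`): `evLW_two_of_ably` turns Ably's measure at
`m = 2` and `m = 1` through the landed penalty spine (`stub_penaltyTransfer` p85905,
`stub_penaltySlotDichotomy_two` p94631) into the penalty form `ApproxTypePenAt 2 s a κ C`, `a < 1`,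
and then into the eventual typed bound past the threshold `H₀(d) = ⌈exp(exp(κ d log(d+2)))⌉`,
stated field by field as
`∃ a b C, a < 1 ∧ 0 < C ∧ ∀ d ∃ H₀ ∀ H γ, H₀ ≤ H → [ℚ(γ):ℚ] ≤ d → (roots clause) →
  exp(−C(dᵃ log H + dᵇ)) ≤ ‖γ − (s, e^s)‖`.
The tail `0 < C ∧ ∀ d …` is VERBATIM `ApproxTypeEvAt 2 s a b C`, so this file is the bridge
(re-bracketing of the existential), nothing more.

## Contents

* `stub_evLW_two_of_ably` — the registered stub, by name.
-/

noncomputable section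

-- `Summit.Schanuel.Schanuel.…` is the mandated summit/sub-problem namespace (single-conjunct summit), hence:
set_option linter.dupNamespace false

namespace Summit.Schanuel.Schanuel.Cruxes.KhovanskiiApproxTypeEv.AnchoredReduction

open Literature.NumberTheory.Transcendental (Ably1994_lindemannWeierstrass_measure)
open Summit.Schanuel.Schanuel.Cruxes.KhovanskiiApproxType.HeightWindowCompactness
  (evLW_two_of_ably)

/-- **The `n = 2` Lindemann–Weierstrass layer of `KhovanskiiApproxTypeEv` from Ably's theorem**
(registered stub `stub_evLW_two_of_ably` of line `anchored-reduction`): CONDITIONAL ONLY on the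
named fact `Ably1994_lindemannWeierstrass_measure` (Ably 1994, Théorème p. 30), every `s ∈ ℚ̄²`
with `ℚ`-linearly independent coordinates has eventual approximation type `a < 1`:
`∃ a b C, a < 1 ∧ ApproxTypeEvAt 2 s a b C`.  The bridge from the landed
`HeightWindowCompactness.evLW_two_of_ably` (p95225), whose conclusion is `ApproxTypeEvAt` written
out field by field. [cite: Ably1994, Théorème p. 30] -/
theorem stub_evLW_two_of_ably : Ably1994_lindemannWeierstrass_measure → EvLWTwo := by
  intro hA s halg hli
  obtain ⟨a, b, C, ha, hC, hall⟩ := evLW_two_of_ably hA s halg hli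
  exact ⟨a, b, C, ha, hC, hall⟩

end Summit.Schanuel.Schanuel.Cruxes.KhovanskiiApproxTypeEv.AnchoredReduction

end
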